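import Literature.NumberTheory.ComplexMultiplication.SexticCMTypesB3NoFlip
import Literature.NumberTheory.ComplexMultiplication.CMTypeCount
import Literature.AlgebraicGeometry.Pohlmann1968.NondegenerateCMTypeDivisorClasses
import Literature.AlgebraicGeometry.Motives.ZarhinHodgeGroupAutC
import HarnessLib

/-!
# A sextic CM field has pair flips or contains an imaginary quadratic field

For a CM field `K` of degree `6`, `Aut(ℂ)` acts on the six complex embeddings `Hom(K, ℂ)` through the Galois group of
the normal closure, commuting with complex conjugation `ρ`, transitively.  A PAIR FLIP at `s` is an automorphism
acting as `ρ` on `{s, s̄}` and trivially on the other four embeddings.  Dodson's list of Galois groups of sextic CM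
fields [Dodson1984, §5.1.2: `ℤ₂ × ℤ₃`, `ℤ₂ × 𝔖₃`, `(ℤ₂)³ ⋊ ℤ₃`, `(ℤ₂)³ ⋊ 𝔖₃`] splits into two halves: the last two
(order `24`, `48`) have all pair flips and no quadratic subfield (the tree's `SexticCMFieldPrimitive`,
`Summits/…/SexticCMFieldPairFlip`); the first two are the fields `K = K⁺·k` through an imaginary quadratic field
`k`.  This file proves the dividing line directly:

* `exists_index_two_of_no_pairFlip` — if there is no pair flip at `s₀` then some subgroup `H ≤ Aut(ℂ)` of index `2`
  contains `Stab(s₀) = Aut(ℂ/s₀(K))` and misses `ρ` (the finite group theory of `SexticCMTypesB3NoFlip`, applied to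
  `G = Aut(ℂ)` — transitivity is the tree's `Pohlmann1968.isPretransitive_ringEquiv_complex`);
* `exists_quadratic_of_index_two` — such an `H` cuts out an IMAGINARY QUADRATIC SUBFIELD of `K`: in the normal
  closure `C` of `s₀(K)` in `ℂ`, `H` is the preimage of an index-two subgroup `H̄ ≤ Gal(C/ℚ)` above `Gal(C/s₀(K))`,
  whose fixed field is a quadratic subfield of `s₀(K)` moved by `ρ` (Galois correspondence; restriction
  `Aut(ℂ) → Gal(C/ℚ)` is onto by `Motives.ZarhinLie.exists_ringEquiv_complex_comp_eq`);
* **`pairFlip_or_exists_imaginary_quadratic`** — for a sextic CM field `K`: EITHER every conjugate pair of complex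
  embeddings is flipped by an automorphism of `ℂ` fixing the other four, OR `K` contains a subfield `F` with
  `[F : ℚ] = 2` and `F` totally complex.

(The two cases are exclusive — a flip at `s` would fix the two other embeddings over `s|_k` and move `s|_k` —
see the `CorCM` census file.)  Theorems only; no definition, no `sorry`.

## References

* B. Dodson, *The structure of Galois groups of CM-fields*, Trans. AMS 283 (1984) 1–32 [Dodson1984], §1.1, §5.1.2.
* S. Lang, *Algebra*, 3rd ed. [Lang2002], VI §1 Thm. 1.1, Thm. 1.8, Cor. 1.6 (Galois correspondence), V §2 Thm. 2.8.
-/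

noncomputable section

open IntermediateField Module NumberField NumberField.ComplexEmbedding

namespace Literature.NumberTheory.ComplexMultiplication

open Literature.AlgebraicGeometry.Pohlmann1968 (isCMTypeWith_conj isPretransitive_ringEquiv_complex
  conj_smul_eq_conjugate)

variable {K : Type} [Field K] [NumberField K]

/-! ## §1 No pair flip at `s₀` ⟹ an index-two subgroup of `Aut(ℂ)` above `Aut(ℂ/s₀(K))` missing `ρ` -/

/-- **No pair flip ⟹ index two above the stabiliser** (`G = Aut(ℂ)` on the six embeddings of a sextic CM field,
`c` = complex conjugation): if no automorphism of `ℂ` acts as `ρ` on `{s₀, s̄₀}` and trivially on the other four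
embeddings, some `H ≤ Aut(ℂ)` of index `2` contains `Stab(s₀)` and not `ρ`. [cite: Dodson1984, §5.1.2 Theorem] -/
theorem exists_index_two_of_no_pairFlip [IsCMField K] (h6 : finrank ℚ K = 6) (s₀ : K →+* ℂ)
    (hno : ∀ σ : ℂ ≃+* ℂ, σ • s₀ = (starRingAut : ℂ ≃+* ℂ) • s₀ →
      ∃ t : K →+* ℂ, t ≠ s₀ ∧ t ≠ (starRingAut : ℂ ≃+* ℂ) • s₀ ∧ σ • t ≠ t) :
    ∃ H : Subgroup (ℂ ≃+* ℂ), H.index = 2 ∧ MulAction.stabilizer (ℂ ≃+* ℂ) s₀ ≤ H ∧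
      (starRingAut : ℂ ≃+* ℂ) ∉ H := by
  classical
  have hX : Fintype.card (K →+* ℂ) = 6 := by rw [Embeddings.card, h6]
  have hcm := isCMTypeWith_conj (CMTypeCount.stdCMType (K := K))
  haveI := isPretransitive_ringEquiv_complex (K := K)
  exact SexticB3.exists_index_two_of_no_flip hX (starRingAut : ℂ ≃+* ℂ) (fun g x => (hcm.comm g x).symm)
    hcm.invol (fun x => by rw [conj_smul_eq_conjugate]; exact CMTypeCount.conjugate_ne_self x)
    (fun x y => MulAction.exists_smul_eq (ℂ ≃+* ℂ) x y) s₀ hno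

/-! ## §2 An index-two subgroup of `Aut(ℂ)` above `Aut(ℂ/s₀(K))` missing `ρ` cuts out an imaginary quadratic
subfield of `K` -/

/-- A finite-dimensional intermediate field of `ℂ/ℚ` is countable. [folklore] -/
private theorem countable_of_finiteDimensional''' (C : IntermediateField ℚ ℂ) [FiniteDimensional ℚ C] :
    Countable C :=
  Countable.of_equiv _ (Module.finBasis ℚ C).equivFun.toEquiv.symm

/-- **Galois correspondence for `Aut(ℂ)` above `Aut(ℂ/s₀(K))`.**  If `H ≤ Aut(ℂ)` has index `2`, contains the
stabiliser of the embedding `s₀ : K → ℂ` and does not contain complex conjugation, then `K` has a subfield `F` with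
`[F : ℚ] = 2` which is totally complex (the fixed field of the image of `H` in `Gal(C/ℚ)`, `C` the normal closure of
`s₀(K)`, pulled back along `s₀`; conjugation moves it). [cite: Lang2002, VI §1 Thm. 1.1, Thm. 1.8 and Cor. 1.6] -/
theorem exists_quadratic_of_index_two (s₀ : K →+* ℂ) (H : Subgroup (ℂ ≃+* ℂ)) (hidx : H.index = 2)
    (hstab : MulAction.stabilizer (ℂ ≃+* ℂ) s₀ ≤ H) (hc : (starRingAut : ℂ ≃+* ℂ) ∉ H) :
    ∃ F : IntermediateField ℚ K, finrank ℚ F = 2 ∧ IsTotallyComplex F := by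
  classical
  -- `E = s₀(K)` and its normal closure `C` in `ℂ` (finite Galois over `ℚ`)
  set E : IntermediateField ℚ ℂ := s₀.toRatAlgHom.fieldRange with hE
  letI iE : Algebra ℚ ↥E := IntermediateField.algebra' _
  haveI : FiniteDimensional ℚ ↥E := s₀.toRatAlgHom.toLinearMap.finiteDimensional_range
  let C : IntermediateField ℚ ℂ := normalClosure ℚ ↥E ℂ
  letI iC : Algebra ℚ ↥C := IntermediateField.algebra' C
  have hEC : E ≤ C := IntermediateField.le_normalClosure _
  haveI : Normal ℚ ↥C := by
    haveI := Algebra.IsAlgebraic.isNormalClosure_normalClosure (F := ℚ) (K := ↥E) (L := ℂ)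
      fun x => IsAlgClosed.splits _
    exact IsNormalClosure.normal (K := ↥E)
  haveI : Algebra.IsSeparable ℚ (↥C) := Algebra.IsAlgebraic.isSeparable_of_perfectField
  haveI : IsGalois ℚ (↥C) := ⟨⟩
  haveI : Countable ↥C := countable_of_finiteDimensional''' C
  haveI : CharZero ↥C := charZero_of_injective_algebraMap (algebraMap ℚ ↥C).injective
  haveI : NumberField ↥C := @NumberField.mk _ _ inferInstance inferInstance
  let E' : IntermediateField ℚ ↥C := IntermediateField.restrict hEC
  -- restriction `Aut(ℂ) → Gal(C/ℚ)` as a group homomorphism, onto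
  have hq : ∀ (σ : ℂ ≃+* ℂ) (q : ℚ), σ (algebraMap ℚ ℂ q) = algebraMap ℚ ℂ q := fun σ q => by
    rw [eq_ratCast]; exact map_ratCast σ q
  let res : (ℂ ≃+* ℂ) →* (↥C ≃ₐ[ℚ] ↥C) :=
    { toFun := fun σ => (AlgEquiv.ofRingEquiv (f := σ) (hq σ)).restrictNormal ↥C
      map_one' := AlgEquiv.ext fun x => Subtype.ext (by
        rw [AlgEquiv.one_apply]
        exact (AlgEquiv.restrictNormal_commutes _ ↥C x).trans rfl)
      map_mul' := fun σ τ => by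
        apply AlgEquiv.ext
        intro x
        apply Subtype.ext
        have h1 : (((AlgEquiv.ofRingEquiv (f := σ * τ) (hq (σ * τ))).restrictNormal ↥C x : ↥C) : ℂ) =
            (σ * τ) x := AlgEquiv.restrictNormal_commutes _ ↥C x
        have h2 : (((AlgEquiv.ofRingEquiv (f := σ) (hq σ)).restrictNormal ↥C
            ((AlgEquiv.ofRingEquiv (f := τ) (hq τ)).restrictNormal ↥C x) : ↥C) : ℂ) =
            σ (((AlgEquiv.ofRingEquiv (f := τ) (hq τ)).restrictNormal ↥C x : ↥C) : ℂ) :=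
          AlgEquiv.restrictNormal_commutes _ ↥C _
        have h3 : (((AlgEquiv.ofRingEquiv (f := τ) (hq τ)).restrictNormal ↥C x : ↥C) : ℂ) = τ x :=
          AlgEquiv.restrictNormal_commutes _ ↥C x
        rw [AlgEquiv.mul_apply, h1, h2, h3, RingAut.mul_apply] }
  have hres : ∀ (σ : ℂ ≃+* ℂ) (x : ↥C), ((res σ x : ↥C) : ℂ) = σ x := fun σ x =>
    AlgEquiv.restrictNormal_commutes (AlgEquiv.ofRingEquiv (f := σ) (hq σ)) ↥C x
  have hsurj : Function.Surjective res := fun γ => by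
    obtain ⟨σ, hσ⟩ := Literature.AlgebraicGeometry.Motives.ZarhinLie.exists_ringEquiv_complex_comp_eq
      (algebraMap (↥C) ℂ) ((algebraMap (↥C) ℂ).comp γ.toRingEquiv.toRingHom)
    exact ⟨σ, AlgEquiv.ext fun x => Subtype.ext ((hres σ x).trans (hσ x))⟩
  -- an automorphism of `ℂ` fixing `E` pointwise stabilises `s₀`, hence lies in `H`
  have hfixE : ∀ σ : ℂ ≃+* ℂ, (∀ a : K, σ (s₀ a) = s₀ a) → σ ∈ H := fun σ hσ =>
    hstab (by
      rw [MulAction.mem_stabilizer_iff]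
      exact RingHom.ext fun a => by rw [ringEquiv_smul_apply, hσ a])
  have hker : res.ker ≤ H := fun σ hσ => hfixE σ fun a => by
    have hx : s₀ a ∈ C := hEC (AlgHom.mem_fieldRange.2 ⟨a, rfl⟩)
    have h := congrArg (fun γ : ↥C ≃ₐ[ℚ] ↥C => ((γ ⟨s₀ a, hx⟩ : ↥C) : ℂ)) (MonoidHom.mem_ker.1 hσ)
    simp only [hres, AlgEquiv.one_apply] at h
    exact h
  -- the image `H̄` of `H`: index two in `Gal(C/ℚ)`, above `Gal(C/E')`, missing the restriction of `ρ`
  set Hb : Subgroup (↥C ≃ₐ[ℚ] ↥C) := H.map res with hHb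
  have hcomap : Hb.comap res = H := Subgroup.comap_map_eq_self hker
  have hidxb : Hb.index = 2 := by
    have h := Subgroup.index_comap_of_surjective Hb hsurj
    rw [hcomap, hidx] at h
    exact h.symm
  have hEHb : E'.fixingSubgroup ≤ Hb := fun γ hγ => by
    obtain ⟨σ, rfl⟩ := hsurj γ
    refine Subgroup.mem_map_of_mem res (hfixE σ fun a => ?_)
    have hx : s₀ a ∈ E := AlgHom.mem_fieldRange.2 ⟨a, rfl⟩
    have h := (IntermediateField.mem_fixingSubgroup_iff _ _).1 hγ ⟨s₀ a, hEC hx⟩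
      ((IntermediateField.mem_restrict hEC _).2 hx)
    have h' := congrArg Subtype.val h
    rw [hres] at h'
    exact h'
  have hcb : res starRingAut ∉ Hb := fun h => hc (by rw [← hcomap]; exact Subgroup.mem_comap.2 h)
  -- its fixed field `F'`: quadratic, inside `E'`, moved by `ρ`
  set F' : IntermediateField ℚ ↥C := IntermediateField.fixedField Hb with hF'
  have hF'E : F' ≤ E' :=
    (IntermediateField.fixedField_le hEHb).trans (IsGalois.fixedField_fixingSubgroup E').le
  have hF'2 : finrank ℚ ↥F' = 2 := by
    have hcardG : Nat.card (↥C ≃ₐ[ℚ] ↥C) = finrank ℚ ↥C := IsGalois.card_aut_eq_finrank ℚ ↥C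
    have hHi : Nat.card Hb * 2 = Nat.card (↥C ≃ₐ[ℚ] ↥C) := by rw [← hidxb]; exact Hb.card_mul_index
    have hfix : finrank ↥F' ↥C = Nat.card Hb := IntermediateField.finrank_fixedField_eq_card Hb
    have htower := Module.finrank_mul_finrank ℚ ↥F' ↥C
    rw [hfix, ← hcardG, ← hHi] at htower
    have hpos : 0 < Nat.card Hb := Nat.card_pos
    have : finrank ℚ ↥F' * Nat.card Hb = 2 * Nat.card Hb := by rw [htower, mul_comm]
    exact Nat.eq_of_mul_eq_mul_right hpos this
  obtain ⟨z, hzF', hz⟩ : ∃ z : ↥C, z ∈ F' ∧ res starRingAut z ≠ z := by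
    by_contra h
    push Not at h
    exact hcb (by
      rw [← IntermediateField.fixingSubgroup_fixedField Hb]
      exact (IntermediateField.mem_fixingSubgroup_iff _ _).2 h)
  have hz' : starRingEnd ℂ (z : ℂ) ≠ (z : ℂ) := fun h => hz (Subtype.ext (by rw [hres]; exact h))
  -- `F'` as an abstract field: a number field of degree `2`, totally complex
  haveI : FiniteDimensional ℚ ↥F' := inferInstance
  have htc : IsTotallyComplex ↥F' := by
    -- the two embeddings `ι` (inclusion) and `ῑ`; both non-real since `ρ` moves `z ∈ F'`
    let ι : ↥F' →+* ℂ := (algebraMap (↥C) ℂ).comp (algebraMap (↥F') (↥C))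
    have hιz : ι ⟨z, hzF'⟩ = (z : ℂ) := rfl
    have hne : conjugate ι ≠ ι := fun h => hz' (by
      have := RingHom.congr_fun h ⟨z, hzF'⟩
      rw [conjugate_coe_eq, hιz] at this
      exact this)
    have hall : ∀ φ : ↥F' →+* ℂ, φ = ι ∨ φ = conjugate ι := by
      intro φ
      by_contra hφ
      push Not at hφ
      have hle : ({ι, conjugate ι, φ} : Finset (↥F' →+* ℂ)).card ≤ 2 := by
        rw [← hF'2, ← Embeddings.card (↥F') ℂ]
        exact Finset.card_le_univ _
      rw [Finset.card_insert_of_notMem, Finset.card_pair (Ne.symm hφ.2)] at hle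
      · omega
      · simp only [Finset.mem_insert, Finset.mem_singleton, not_or]
        exact ⟨hne.symm, Ne.symm hφ.1⟩
    have hnr : ∀ φ : ↥F' →+* ℂ, ¬ ComplexEmbedding.IsReal φ := by
      intro φ hφ
      rw [ComplexEmbedding.isReal_iff] at hφ
      rcases hall φ with rfl | rfl
      · exact hne hφ
      · rw [show conjugate (conjugate ι) = ι from ComplexEmbedding.involutive_conjugate (↥F') ι] at hφ
        exact hne hφ.symm
    exact ⟨fun v => InfinitePlace.isComplex_iff.2 (hnr v.embedding)⟩
  -- pull `F'` back to `K` along `s₀ : K ≃ E ≃ E' ⊇ F'`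
  let j : ↥F' →ₐ[ℚ] K :=
    (AlgEquiv.ofInjectiveField s₀.toRatAlgHom).symm.toAlgHom.comp
      (((IntermediateField.restrict_algEquiv hEC).symm.toAlgHom).comp (IntermediateField.inclusion hF'E))
  letI iF : Algebra ℚ ↥j.fieldRange := IntermediateField.algebra' _
  refine ⟨j.fieldRange, ((AlgEquiv.ofInjectiveField j).toLinearEquiv.finrank_eq).symm.trans hF'2, ?_⟩
  letI : Algebra ↥F' ↥j.fieldRange := (AlgEquiv.ofInjectiveField j).toRingEquiv.toRingHom.toAlgebra
  haveI := htc
  exact isTotallyComplex_of_algebra ↥F' ↥j.fieldRange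

/-! ## §3 The dichotomy -/

/-- **A sextic CM field has pair flips or contains an imaginary quadratic field.**  For a CM field `K` with
`[K : ℚ] = 6`: either for EVERY complex embedding `s` some automorphism of `ℂ` acts as complex conjugation on `{s, s̄}`
and trivially on the other four embeddings (Galois closure of degree `24` or `48`), or `K` has a subfield `F` with
`[F : ℚ] = 2` which is totally complex (`K = K⁺·F`, Galois closure of degree `6` or `12`).
[cite: Dodson1984, §5.1.2 Theorem] -/
theorem pairFlip_or_exists_imaginary_quadratic [IsCMField K] (h6 : finrank ℚ K = 6) :
    (∀ s : K →+* ℂ, ∃ σ : ℂ ≃+* ℂ, σ • s = (starRingAut : ℂ ≃+* ℂ) • s ∧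
        ∀ t : K →+* ℂ, t ≠ s → t ≠ (starRingAut : ℂ ≃+* ℂ) • s → σ • t = t) ∨
      ∃ F : IntermediateField ℚ K, finrank ℚ F = 2 ∧ IsTotallyComplex F := by
  by_cases h : ∀ s : K →+* ℂ, ∃ σ : ℂ ≃+* ℂ, σ • s = (starRingAut : ℂ ≃+* ℂ) • s ∧
      ∀ t : K →+* ℂ, t ≠ s → t ≠ (starRingAut : ℂ ≃+* ℂ) • s → σ • t = t
  · exact Or.inl h
  · right
    push Not at h
    obtain ⟨s₀, hs₀⟩ := h
    obtain ⟨H, hidx, hstab, hc⟩ := exists_index_two_of_no_pairFlip h6 s₀ hs₀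
    exact exists_quadratic_of_index_two s₀ H hidx hstab hc

end Literature.NumberTheory.ComplexMultiplication

end
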